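import Literature.MathematicalPhysics.QuantumFieldTheory.Balaban1983to89.B5DPD126Uniform
import HarnessLib

/-!
# T⁴ programme, node NE3 — census R38ᴺ (model side): THE `ℓ^∞ → ℓ^∞` NORM OF BAŁABAN's PROJECTION `P = G′Q′*(Q′G′²Q′*)⁻¹Q′G′` IS BOUNDED
# UNIFORMLY IN THE BLOCK SIZE `n = L^k` AND IN THE VOLUME, in the lit-balaban cell's `U = 1` torus multiplier model (`LandauProjectionSupUniformModel`)

Cell `pub-balaban-gaps` (track G2, seat ne3, generation 11), row NE3; census `HOME/ne/NE3.md` §4 R38ᴺ, §17.  ASKED BY NAME by the NE7 crux prover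
(`run/shared/lean/pub/pub-balaban/INBOX.md` [NE7P1-G73-INBOX-4] «gaps-ne3 — R38ᴺ (`‖R‖_{∞→∞} ≤ C(d)`, NOT ∝ N^{d+2})»; road `REP-FLAT-ROAD-v3.md` §3; NE7 pricing desk line
NE7-R38N-1): row NE3's flat projection letter (HR) `LandauProjectionSupFlat.covLapSite_sup_le_flatCfg` (gen 8) carries the constant
`1 + card n + 64^{2d+1}d⁴(card n)²·N^{d+2}` — honest for NE3 (ONE fixed torus, `N` fixed) but NOT for the NE7 gradient road, where the number of blocks grows with the
cutoff.  The N-UNIFORM statement is a DECAY statement and cannot come from the maximum principle; it comes from [Balaban1984PropagatorsI] («B5») (1.44)∕(1.45)∕(1.126).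

WHAT THIS FILE PROVES (0 def, 0 sorry; the matrix of `P` is written inline as the product `KRe·kerRe·QGRe`).  In the lit-balaban `U = 1`, `m² = 0` torus multiplier model of
`B5QGGQ145Torus∕Bounds∕Factor` and `B5DPD126Uniform` (dimension written `d+1`, `n` fine points per unit block, period vector `N`, fine torus `Π_μ Fin (nN_μ)`, unit
torus `Π_μ Fin N_μ`, `a ∈ [a₋, a₊]`, `0 < a₋`; `KRe` = counting-measure matrix of `G′Q′^*`, `kerRe = (Q′G′²Q′^*)⁻¹`, `QGRe = η^{d+1}KReᵀ` = `Q′G′`), the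
counting-measure matrix of `P = G′Q′*(Q′G′²Q′*)⁻¹Q′G′` is `KRe·kerRe·QGRe` (`B5DPD126Uniform.Dmat_matrixP_Dmat_transpose`'s middle factor), and:
* §1 **`matrixP_entry_decay_uniform`** — `|(KRe·kerRe·QGRe)(x, x′)| ≤ η^{d+1}·C·e^{−δ|⌊x∕n⌋ − ⌊x′∕n⌋|_{T₁}}` with `δ > 0`, `C ≥ 0` depending on `d, a₋, a₊` ONLY — the
  undifferentiated twin of `B5DPD126Uniform.dpd_decay_uniform`, by the same composition over the unit torus (`KRe_decay` ∘ `kerRe_decay` ∘ `QGRe_decay`, `conv_decay` twice).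
* §2 `sum_fine_eq_pow_mul_sum_coarse` — block bookkeeping: a function of the block label sums over the fine torus to `n^{d+1}` times its sum over the unit torus.
* §3 **`matrixP_rowSum_le_uniform`** — THE HEADLINE: `Σ_{x′} |(KRe·kerRe·QGRe)(x, x′)| ≤ C_P` for every `n ≥ 1`, `a ∈ [a₋, a₊]`, every period vector and every `x`,
  `C_P = C·K_{d+1}(δ)` depending on `d, a₋, a₊` ONLY; hence **`matrixP_mulVec_sup_le_uniform`**: `‖P f‖_∞ ≤ C_P‖f‖_∞` and `‖(1 − P) f‖_∞ ≤ (1 + C_P)‖f‖_∞` — the `ℓ^∞`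
  operator norms of `P` and of `R = I − P` ([Balaban1985RegularSpaces] (1.38)'s projection at `U₀ = 1`) are bounded UNIFORMLY IN `k` AND IN THE VOLUME, in the model.

WHAT IT DOES NOT DO (honest scope).  The identification of the model's `KRe·kerRe·QGRe` with row NE3's (HR) objects on the T⁴ carriers (`covLapSite flatCfg`,
`avgKernelGauges … flatCfg`, `hsR`-orthogonality on `periodBox (N·L^{j+1})`, `𝔲(n)`-valued fields) is NOT made here — that dictionary (T4 `Site d` ↔ `Π_μ Fin (nN_μ)`,
entrywise in the matrix coordinates; NE7's D-dictionary F35∕F36∕F40 are its linear-level template) is the remaining half of R38ᴺ; until it lands, THE END of row NE3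
and the owner's brick E keep the tree's `N`-dependent `c_R`.  Nothing of Bałaban's is asserted: B5 prints (1.126) for `∂P∂*` with «the constant O(1) depends on d only»
and no proof; the undifferentiated `ℓ^∞` bound is OUR corollary of the lit-balaban cell's kernel-checked factor decays.  **NE3 ∕ NE7 NOT proved**; spine PROVED 0∕9;
finite T⁴ rung (B)+1 — NOT continuum YM on ℝ⁴, NOT infinite volume, NOT mass gap, NOT `BetaPertH`, NOT Clay.  HONEST DEPENDENCY: continuum YM on T⁴ ⇐ BetaPertH ∧ nine
spine estimates (0/9 proved); BetaPertH ⇐ (D1) ∧ (D4) ∧ CAP+tail; G-an2-4 gates asym, D1 and NE2/3/4.  PLACEMENT: our lemma about Literature objects, `Spine/NE3/`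
(row NE3's projection letters R37–R40 live there); imports `B5DPD126Uniform` only.

References: [Balaban1984PropagatorsI] T. Bałaban, *Propagators and renormalization transformations for lattice gauge theories. I*, CMP 95 (1984) 17–40, (1.44)∕(1.45)
p. 25–26, (1.120) p. 37, (1.126) p. 38; [Balaban1983RegularityDecay] T. Bałaban, *Regularity and decay of lattice Green's functions*, CMP 89 (1983) 571–597, Lemma 2.4;
[Balaban1985RegularSpaces] CMP 99 (1985) 75–102, (1.38) p. 82.
-/

set_option autoImplicit false

namespace Summit.QuantumFields.BalabanUV.T4Continuum.NE3.LandauProjectionSupUniformModel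

open Literature.MathematicalPhysics.QuantumFieldTheory.Balaban1983to89
open B4Sect5Torus B4TorusKernel B4Green244 B5QGGQ145Bounds B5QGGQ145Factor B5DPD126Uniform
open scoped Real Matrix

noncomputable section

variable {d : ℕ}

/-! ## §1 Entry decay of the counting-measure matrix of `P`, uniformly in `n` and in the volume -/

/-- **THE ENTRIES OF THE COUNTING-MEASURE MATRIX `KRe·kerRe·QGRe` OF `P = G′Q′*(Q′G′²Q′*)⁻¹Q′G′` DECAY ON THE BLOCK SCALE, UNIFORMLY**: for `0 < a₋ ≤ a₊` there are
`δ > 0`, `C ≥ 0` (depending on `d, a₋, a₊` only) with `|(KRe·kerRe·QGRe)(x,x′)| ≤ (n^{d+1})⁻¹·C·e^{−δ·|⌊x∕n⌋ − ⌊x′∕n⌋|_{T₁}}` for every `n ≥ 1`, `a ∈ [a₋,a₊]`, `N`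
(`N_μ ≥ 1`), `x`, `x′` — the undifferentiated twin of `B5DPD126Uniform.dpd_decay_uniform` (same composition over the unit torus: `KRe_decay`, `kerRe_decay`, `QGRe_decay`,
`conv_decay` twice; the factor `(n^{d+1})⁻¹` is `QGRe = η^{d+1}KReᵀ`). [folklore] -/
theorem matrixP_entry_decay_uniform (d : ℕ) (aminus aplus : ℝ) (ha : 0 < aminus) :
    ∃ δ C : ℝ, 0 < δ ∧ 0 ≤ C ∧ ∀ (n : ℕ) [NeZero n], 1 ≤ n → ∀ (a : ℝ), aminus ≤ a → a ≤ aplus →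
      ∀ (N : Fin (d + 1) → ℕ), (∀ i, 1 ≤ N i) → ∀ (x x' : Idx (fun i => n * N i)),
        |(KRe n a N * kerRe n a N * QGRe n a N) x x'| ≤
          ((n : ℝ) ^ (d + 1))⁻¹ * C * Real.exp (-(δ * tdist N (cIdx n N x) (cIdx n N x'))) := by
  obtain ⟨κ₁, M₁, hκ₁, hM₁, h₁⟩ := KRe_decay d aminus aplus ha
  obtain ⟨κ₂, M₂, hκ₂, hM₂, h₂⟩ := kerRe_decay d aminus aplus ha
  have hd1 : (0 : ℝ) < (d : ℝ) + 1 := by positivity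
  set α : ℝ := min κ₁ κ₂ / ((d : ℝ) + 1) with hα_def
  have hα : 0 < α := div_pos (lt_min hκ₁ hκ₂) hd1
  have hα₁ : α ≤ κ₁ / ((d : ℝ) + 1) := div_le_div_of_nonneg_right (min_le_left _ _) hd1.le
  have hα₂ : α ≤ κ₂ / ((d : ℝ) + 1) := div_le_div_of_nonneg_right (min_le_right _ _) hd1.le
  set A : ℝ := M₁ * periodConst κ₁ d with hA_def
  set B : ℝ := M₂ * periodConst κ₂ d with hB_def
  have hA : 0 ≤ A := mul_nonneg hM₁ (periodConst_nonneg_of_pos hκ₁ d)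
  have hB : 0 ≤ B := mul_nonneg hM₂ (periodConst_nonneg_of_pos hκ₂ d)
  have hK2 : 0 ≤ B4Sect5Proof.latticeConst (d + 1) (α / 2) := B4Sect5Proof.latticeConst_nonneg (d + 1) (by positivity)
  have hK4 : 0 ≤ B4Sect5Proof.latticeConst (d + 1) (α / 2 / 2) :=
    B4Sect5Proof.latticeConst_nonneg (d + 1) (by positivity)
  refine ⟨α / 2 / 2, A * B * B4Sect5Proof.latticeConst (d + 1) (α / 2) * A *
    B4Sect5Proof.latticeConst (d + 1) (α / 2 / 2), by positivity, by positivity, ?_⟩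
  intro n _ hn1 a ha1 ha2 N hN x x'
  have hn0 : (0 : ℝ) < (n : ℝ) ^ (d + 1) := by positivity
  -- the factor bounds at the common rate `α`
  have hKR : ∀ (z : Idx (fun i => n * N i)) (k : Idx N),
      |KRe n a N z k| ≤ A * Real.exp (-(α * tdist N (cIdx n N z) k)) := by
    intro z k
    refine (h₁ n a ha1 ha2 N hN z k).trans ?_
    rw [tdist_eq_torusSupNorm hN, toZ_cIdx]
    apply mul_le_mul_of_nonneg_left _ hA
    apply Real.exp_le_exp.mpr
    have hT := MultiPeriod.torusSupNorm_nonneg hN (coarse n (toZ z) - toZ k)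
    nlinarith
  have hker : ∀ k k' : Idx N, |kerRe n a N k k'| ≤ B * Real.exp (-(α * tdist N k k')) := by
    intro k k'
    refine (h₂ n a ha1 ha2 N hN k k').trans ?_
    rw [tdist_eq_torusSupNorm hN]
    apply mul_le_mul_of_nonneg_left _ hB
    apply Real.exp_le_exp.mpr
    have hT := MultiPeriod.torusSupNorm_nonneg hN (toZ k - toZ k')
    nlinarith
  -- first composition: `G′Q′^* · (Q′G′²Q′^*)⁻¹`
  have hconv1 : ∀ y' : Idx N, |(KRe n a N * kerRe n a N) x y'| ≤
      A * B * B4Sect5Proof.latticeConst (d + 1) (α / 2) * Real.exp (-(α / 2 * tdist N (cIdx n N x) y')) := by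
    intro y'
    rw [Matrix.mul_apply]
    exact conv_decay hN hα _ _ (cIdx n N x) y' (fun y => hKR x y) (fun y => hker y y')
  -- second composition: `· Q′G′`, whose entries are `(n^{d+1})⁻¹` times those of `KRe` transposed
  have hconv2 : |(KRe n a N * kerRe n a N * QGRe n a N) x x'| ≤
      A * B * B4Sect5Proof.latticeConst (d + 1) (α / 2) * (((n : ℝ) ^ (d + 1))⁻¹ * A) *
        B4Sect5Proof.latticeConst (d + 1) (α / 2 / 2) * Real.exp (-(α / 2 / 2 * tdist N (cIdx n N x) (cIdx n N x'))) := by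
    rw [Matrix.mul_apply]
    refine conv_decay hN (half_pos hα) _ _ (cIdx n N x) (cIdx n N x') hconv1 ?_
    intro y'
    rw [QGRe_apply, abs_mul, abs_of_nonneg (le_of_lt (inv_pos.mpr hn0)), tdist_symm hN]
    rw [mul_assoc]
    refine mul_le_mul_of_nonneg_left ((hKR x' y').trans ?_) (le_of_lt (inv_pos.mpr hn0))
    apply mul_le_mul_of_nonneg_left _ hA
    apply Real.exp_le_exp.mpr
    have ht := mul_nonneg hα.le (tdist_nonneg N (cIdx n N x') y')
    nlinarith
  refine hconv2.trans (le_of_eq ?_)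
  ring

/-! ## §2 Block bookkeeping: summing a function of the block label over the fine torus -/

/-- **A FUNCTION OF THE BLOCK LABEL SUMS OVER THE FINE TORUS TO `n^{d+1}` TIMES ITS SUM OVER THE UNIT TORUS** (every block has `n^{d+1}` fine sites; the
fine torus is re-indexed as «block label × position in the block» through Mathlib's `finProdFinEquiv` coordinatewise, `x ↦ (⌊x∕n⌋, x mod n)`). [folklore] -/
theorem sum_fine_eq_pow_mul_sum_coarse (n : ℕ) [NeZero n] (N : Fin (d + 1) → ℕ) (g : Idx N → ℝ) :
    ∑ x : Idx (fun i => n * N i), g (cIdx n N x) = (n : ℝ) ^ (d + 1) * ∑ k : Idx N, g k := by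
  -- the splitting `Π_i Fin (n·N_i) ≃ (Π_i Fin N_i) × (Π_i Fin n)`
  let e : Idx (fun i => n * N i) ≃ Idx N × (Fin (d + 1) → Fin n) :=
    (Equiv.piCongrRight fun i => (finCongr (Nat.mul_comm n (N i))).trans finProdFinEquiv.symm).trans
      (Equiv.arrowProdEquivProdArrow _ _ _)
  have he : ∀ x : Idx (fun i => n * N i), (e x).1 = cIdx n N x := by
    intro x
    funext i
    apply Fin.ext
    simp [e, cIdx, Fin.divNat]
  have h1 : ∑ x : Idx (fun i => n * N i), g (cIdx n N x) = ∑ p : Idx N × (Fin (d + 1) → Fin n), g p.1 := by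
    refine Fintype.sum_equiv e _ _ fun x => ?_
    rw [he]
  rw [h1, Fintype.sum_prod_type]
  simp only [Finset.sum_const, Finset.card_univ, Fintype.card_fun, Fintype.card_fin, nsmul_eq_mul]
  rw [Finset.mul_sum]
  refine Finset.sum_congr rfl fun k _ => ?_
  push_cast
  ring

/-! ## §3 The `ℓ^∞ → ℓ^∞` norm of `P` and of `R = I − P`, uniformly in `n` and in the volume -/

/-- **R38ᴺ IN THE MODEL — THE ROW SUMS OF THE MATRIX OF `P` ARE BOUNDED UNIFORMLY IN THE BLOCK SIZE AND IN THE VOLUME**: for `0 < a₋ ≤ a₊` there is `C_P ≥ 0` depending on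
`d, a₋, a₊` ONLY such that `Σ_{x′} |(KRe·kerRe·QGRe)(x, x′)| ≤ C_P` for every `n ≥ 1`, `a ∈ [a₋, a₊]`, every period vector `N` (`N_μ ≥ 1`) and every fine site `x`
(`C_P = C·K_{d+1}(δ)` with the constants of §1 and `B4Sect5Proof.latticeConst`). [folklore] -/
theorem matrixP_rowSum_le_uniform (d : ℕ) (aminus aplus : ℝ) (ha : 0 < aminus) :
    ∃ CP : ℝ, 0 ≤ CP ∧ ∀ (n : ℕ) [NeZero n], 1 ≤ n → ∀ (a : ℝ), aminus ≤ a → a ≤ aplus →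
      ∀ (N : Fin (d + 1) → ℕ), (∀ i, 1 ≤ N i) → ∀ (x : Idx (fun i => n * N i)),
        ∑ x' : Idx (fun i => n * N i), |(KRe n a N * kerRe n a N * QGRe n a N) x x'| ≤ CP := by
  obtain ⟨δ, C, hδ, hC, h⟩ := matrixP_entry_decay_uniform d aminus aplus ha
  have hK : 0 ≤ B4Sect5Proof.latticeConst (d + 1) δ := B4Sect5Proof.latticeConst_nonneg (d + 1) hδ.le
  refine ⟨C * B4Sect5Proof.latticeConst (d + 1) δ, by positivity, fun n _ hn1 a ha1 ha2 N hN x => ?_⟩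
  have hn0 : (0 : ℝ) < (n : ℝ) ^ (d + 1) := by positivity
  calc ∑ x' : Idx (fun i => n * N i), |(KRe n a N * kerRe n a N * QGRe n a N) x x'|
      ≤ ∑ x' : Idx (fun i => n * N i), ((n : ℝ) ^ (d + 1))⁻¹ * C * Real.exp (-(δ * tdist N (cIdx n N x) (cIdx n N x'))) :=
        Finset.sum_le_sum fun x' _ => h n hn1 a ha1 ha2 N hN x x'
    _ = (n : ℝ) ^ (d + 1) * ∑ k : Idx N, ((n : ℝ) ^ (d + 1))⁻¹ * C * Real.exp (-(δ * tdist N (cIdx n N x) k)) :=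
        sum_fine_eq_pow_mul_sum_coarse n N (fun k => ((n : ℝ) ^ (d + 1))⁻¹ * C * Real.exp (-(δ * tdist N (cIdx n N x) k)))
    _ = C * ∑ k : Idx N, Real.exp (-(δ * tdist N (cIdx n N x) k)) := by
        rw [← Finset.mul_sum, ← mul_assoc, ← mul_assoc, mul_inv_cancel₀ hn0.ne', one_mul]
    _ ≤ C * B4Sect5Proof.latticeConst (d + 1) δ := mul_le_mul_of_nonneg_left (torusSum_le (d + 1) hN hδ (cIdx n N x)) hC

/-- **`‖P f‖_∞ ≤ C_P·‖f‖_∞` UNIFORMLY IN `n` AND IN THE VOLUME** (the `ℓ^∞` operator norm of the counting-measure matrix of `P`). [folklore] -/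
theorem matrixP_mulVec_sup_le_uniform (d : ℕ) (aminus aplus : ℝ) (ha : 0 < aminus) :
    ∃ CP : ℝ, 0 ≤ CP ∧ ∀ (n : ℕ) [NeZero n], 1 ≤ n → ∀ (a : ℝ), aminus ≤ a → a ≤ aplus →
      ∀ (N : Fin (d + 1) → ℕ), (∀ i, 1 ≤ N i) → ∀ (f : Idx (fun i => n * N i) → ℝ) (B : ℝ), (∀ x', |f x'| ≤ B) →
        ∀ x : Idx (fun i => n * N i), |((KRe n a N * kerRe n a N * QGRe n a N) *ᵥ f) x| ≤ CP * B := by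
  obtain ⟨CP, hCP, h⟩ := matrixP_rowSum_le_uniform d aminus aplus ha
  refine ⟨CP, hCP, fun n _ hn1 a ha1 ha2 N hN f B hf x => ?_⟩
  have hB : 0 ≤ B := (abs_nonneg _).trans (hf x)
  rw [Matrix.mulVec, dotProduct]
  calc |∑ x', (KRe n a N * kerRe n a N * QGRe n a N) x x' * f x'|
      ≤ ∑ x', |(KRe n a N * kerRe n a N * QGRe n a N) x x' * f x'| := Finset.abs_sum_le_sum_abs _ _
    _ ≤ ∑ x', |(KRe n a N * kerRe n a N * QGRe n a N) x x'| * B := Finset.sum_le_sum fun x' _ => by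
        rw [abs_mul]; exact mul_le_mul_of_nonneg_left (hf x') (abs_nonneg _)
    _ = (∑ x', |(KRe n a N * kerRe n a N * QGRe n a N) x x'|) * B := (Finset.sum_mul _ _ _).symm
    _ ≤ CP * B := mul_le_mul_of_nonneg_right (h n hn1 a ha1 ha2 N hN x) hB

/-- **`‖(1 − P) f‖_∞ ≤ (1 + C_P)·‖f‖_∞` UNIFORMLY** — the `ℓ^∞` operator norm of (the counting-measure matrix of) `R = I − P`, [Balaban1985RegularSpaces] (1.38)'s
projection at `U₀ = 1`, read in the model. [folklore] -/
theorem matrixR_mulVec_sup_le_uniform (d : ℕ) (aminus aplus : ℝ) (ha : 0 < aminus) :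
    ∃ CP : ℝ, 0 ≤ CP ∧ ∀ (n : ℕ) [NeZero n], 1 ≤ n → ∀ (a : ℝ), aminus ≤ a → a ≤ aplus →
      ∀ (N : Fin (d + 1) → ℕ), (∀ i, 1 ≤ N i) → ∀ (f : Idx (fun i => n * N i) → ℝ) (B : ℝ), (∀ x', |f x'| ≤ B) →
        ∀ x : Idx (fun i => n * N i), |((1 - KRe n a N * kerRe n a N * QGRe n a N) *ᵥ f) x| ≤ (1 + CP) * B := by
  obtain ⟨CP, hCP, h⟩ := matrixP_mulVec_sup_le_uniform d aminus aplus ha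
  refine ⟨CP, hCP, fun n _ hn1 a ha1 ha2 N hN f B hf x => ?_⟩
  rw [Matrix.sub_mulVec, Matrix.one_mulVec, Pi.sub_apply]
  calc |f x - ((KRe n a N * kerRe n a N * QGRe n a N) *ᵥ f) x|
      ≤ |f x| + |((KRe n a N * kerRe n a N * QGRe n a N) *ᵥ f) x| := abs_sub _ _
    _ ≤ B + CP * B := add_le_add (hf x) (h n hn1 a ha1 ha2 N hN f B hf x)
    _ = (1 + CP) * B := by ring

end

end Summit.QuantumFields.BalabanUV.T4Continuum.NE3.LandauProjectionSupUniformModel
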